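import Summits.SmoothPoincare4.SmoothPoincare4.Theorems.DottedCircleRasmussenDcrGapStubHandlebodyChartRedAux
import Literature.Topology.FourManifolds.OneHandleUniqueness
import Mathlib.Analysis.SpecialFunctions.SmoothTransition
import Mathlib.Analysis.InnerProductSpace.Calculus

/-!
# Stub `stub_handlebodyChart` of line `mk_friends` for crux `DcrGap`: the arc step of the
# conditional reduction (item stmt-SmoothPoincare4-16128, route route-SmoothPoincare4-DottedCircleRasmussen)

Second file of the reduction `helper_handlebodyChart_of_facts2` (stub D — a germ chart of the model
dotted handlebody `D_k ⊂ ℝ⁴` in a closed simply connected `4`-manifold extends, up to per-handle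
sphere twists, to a global chart — from the Literature facts
`oneHandle_ambientIsotopic_upToTwist`, `arcs_ambientIsotopic_rel_of_homotopicRel`
(`Literature/Topology/FourManifolds/OneHandleUniqueness.lean`) and the model handle lemma), after
`…StubHandlebodyChartRedAux.lean`.  Everything here is proved:

* `handlebodyChart_germ_comp` — a germ chart composed with a smooth injective immersion of a
  model domain is smooth, injective and immersive (chain rule);
* `helper_handlebodyChart_coreLine` (registered helper) — the core line `t ↦ (t, 0, 0, 0)`;
* `handlebodyChart_rot_mem`, `handlebodyChart_rot_rot_neg` — the handle twist
  `R_m (p) = (p₀, p₁, rot(2π m χ(p₀ + 1/2)) (p₂, p₃))` preserves the solid cylinder `T` and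
  `R_m ∘ R_{-m} = id`;
* `handlebodyChart_arcStep` — **step (2) of D**: given a germ chart `i` on `U`, a global chart
  `e₁` agreeing with `i` on the base ball `B̄(c, 3a/2) ⊆ U`, and handle charts `h j` entering the
  ball conically with pairwise disjoint images, the fact `arcs_ambientIsotopic_rel_of_homotopicRel`
  yields a diffeomorphism `Φ` of `X` with `Φ ∘ i = e₁` on `B̄(c, 4a/3)` and on the `k` core arcs
  `h j (t, 0, 0, 0)`, `|t| ≤ 1`.  The homotopies come from the simple connectivity of
  `X ∖ e₁(B(c, 3a/2))` (`handlebodyChart_simplyConnected_compl_ball`, `handlebodyChart_homotopy`),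
  in which the middle parts of the arcs lie because the tubes leave the ball.

References: H. Whitney, *Differentiable manifolds*, Ann. of Math. 37 (1936) §II Thm. 6
[Whitney1936]; J. Milnor, *Lectures on the h-cobordism theorem* (1965), Thm. 8.4 [MilnorHCobordism1965];
M. W. Hirsch, *Differential Topology* (1976), Ch. 8 §1 Thm. 1.3 [HirschDT1976].
-/

-- the prescribed namespace `Summit.<P>.<Sub>.…` duplicates `SmoothPoincare4` (P = Sub)
set_option linter.dupNamespace false

noncomputable section

open scoped Manifold ContDiff Topology unitInterval
open Function Set Metric
open Literature.Topology.FourManifolds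

namespace Summit.SmoothPoincare4.SmoothPoincare4.Theorems.DcrGap.MkFriends

/-- Local notation: `𝔼4` is `EuclideanSpace ℝ (Fin 4)`. -/
local notation "𝔼4" => EuclideanSpace ℝ (Fin 4)

/-! ## Germ charts composed with model maps; the core line; the model cylinder -/

/-- **A germ chart composed with a smooth injective immersion of a model domain is smooth,
injective and immersive** (chain rule): if `f : ℝ⁴ → X` is smooth, injective and immersive on the
open `U` and `g : F → ℝ⁴` (`F` a normed space) is smooth and injective with injective derivative
on the open `V`, mapping `V` into `U`, then `f ∘ g` has the same three properties on `V`.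
[folklore] -/
theorem handlebodyChart_germ_comp {X : Type} [TopologicalSpace X] [ChartedSpace 𝔼4 X]
    [IsManifold (𝓡 4) ∞ X] {F : Type} [NormedAddCommGroup F] [NormedSpace ℝ F]
    {U : Set 𝔼4} (hU : IsOpen U) {f : 𝔼4 → X}
    (hf : ContMDiffOn (𝓡 4) (𝓡 4) ∞ f U ∧ InjOn f U ∧
      ∀ x ∈ U, Injective (mfderiv (𝓡 4) (𝓡 4) f x))
    {V : Set F} (hV : IsOpen V) {g : F → 𝔼4} (hg : ContDiffOn ℝ ∞ g V) (hginj : InjOn g V)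
    (hgd : ∀ v ∈ V, Injective (fderiv ℝ g v)) (hgU : MapsTo g V U) :
    ContMDiffOn 𝓘(ℝ, F) (𝓡 4) ∞ (f ∘ g) V ∧ InjOn (f ∘ g) V ∧
      ∀ v ∈ V, Injective (mfderiv 𝓘(ℝ, F) (𝓡 4) (f ∘ g) v) := by
  refine ⟨hf.1.comp hg.contMDiffOn hgU,
    fun v hv w hw hvw => hginj hv hw (hf.2.1 (hgU hv) (hgU hw) hvw), fun v hv => ?_⟩
  have hn : (∞ : WithTop ℕ∞) ≠ 0 := by simp
  have h1 : MDifferentiableAt (𝓡 4) (𝓡 4) f (g v) :=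
    (hf.1.contMDiffAt (hU.mem_nhds (hgU hv))).mdifferentiableAt hn
  have h2 : MDifferentiableAt 𝓘(ℝ, F) (𝓡 4) g v :=
    (hg.contMDiffOn.contMDiffAt (hV.mem_nhds hv)).mdifferentiableAt hn
  rw [mfderiv_comp v h1 h2]
  have h3 : mfderiv 𝓘(ℝ, F) (𝓡 4) g v = fderiv ℝ g v := mfderiv_eq_fderiv
  rw [h3]
  exact (hf.2.2 _ (hgU hv)).comp (hgd v hv)

/-- **Registered helper `helper_handlebodyChart_coreLine`: the core line `t ↦ (t, 0, 0, 0)` of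
the model cylinder** is smooth and injective with injective derivative, and has the displayed
coordinates (`(t, 0, 0, 0) = t • e₀`; the core arcs of the handles are the tubes composed with
it). [folklore] -/
theorem helper_handlebodyChart_coreLine : ContDiff ℝ ((⊤ : ℕ∞) : WithTop ℕ∞) (fun t : ℝ => (!₂[t, 0, 0, 0] : EuclideanSpace ℝ (Fin 4))) ∧ Function.Injective (fun t : ℝ => (!₂[t, 0, 0, 0] : EuclideanSpace ℝ (Fin 4))) ∧ (∀ t, Function.Injective (fderiv ℝ (fun t : ℝ => (!₂[t, 0, 0, 0] : EuclideanSpace ℝ (Fin 4))) t)) ∧ ∀ t : ℝ, (!₂[t, 0, 0, 0] : EuclideanSpace ℝ (Fin 4)) 0 = t ∧ (!₂[t, 0, 0, 0] : EuclideanSpace ℝ (Fin 4)) 1 = 0 ∧ (!₂[t, 0, 0, 0] : EuclideanSpace ℝ (Fin 4)) 2 = 0 ∧ (!₂[t, 0, 0, 0] : EuclideanSpace ℝ (Fin 4)) 3 = 0 := by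
  set v₀ : 𝔼4 := !₂[1, 0, 0, 0] with hv₀
  have hv : (fun t : ℝ => (!₂[t, 0, 0, 0] : 𝔼4)) = fun t => t • v₀ := by
    funext t
    ext i
    fin_cases i <;> simp [hv₀]
  have hv0 : v₀ ≠ 0 := fun h => by
    have : v₀ 0 = 0 := by rw [h]; rfl
    simp [hv₀] at this
  refine ⟨?_, ?_, fun t => ?_, fun t => by simp⟩
  · rw [hv]; exact contDiff_id.smul contDiff_const
  · rw [hv]; exact smul_left_injective ℝ hv0
  · have hd : HasFDerivAt (fun t : ℝ => t • v₀) ((ContinuousLinearMap.id ℝ ℝ).smulRight v₀) t :=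
      (hasFDerivAt_id t).smul_const v₀
    rw [hv, hd.fderiv]
    intro u w huw
    have : u • v₀ = w • v₀ := by simpa using huw
    exact smul_left_injective ℝ hv0 this

/-- **The fibre rotation of the cylinder by an angle preserves the cylinder**: rotating
`(p₂, p₃)` keeps `p₀`, `p₁` and `p₂² + p₃²`. [folklore] -/
theorem handlebodyChart_rot_mem (θ : ℝ) {p : 𝔼4}
    (hp : p ∈ {p : 𝔼4 | |p 0| ≤ 1 ∧ (p 1) ^ 2 + (p 2) ^ 2 + (p 3) ^ 2 ≤ 1}) :
    (!₂[p 0, p 1, Real.cos θ * p 2 - Real.sin θ * p 3, Real.sin θ * p 2 + Real.cos θ * p 3] : 𝔼4) ∈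
      {p : 𝔼4 | |p 0| ≤ 1 ∧ (p 1) ^ 2 + (p 2) ^ 2 + (p 3) ^ 2 ≤ 1} := by
  obtain ⟨h0, h1⟩ := hp
  refine ⟨by simpa using h0, ?_⟩
  have key : (Real.cos θ * p 2 - Real.sin θ * p 3) ^ 2 + (Real.sin θ * p 2 + Real.cos θ * p 3) ^ 2 =
      (p 2) ^ 2 + (p 3) ^ 2 := by nlinarith [Real.cos_sq_add_sin_sq θ]
  simp only [Matrix.cons_val_one, Matrix.cons_val_zero, Matrix.cons_val]
  nlinarith [key, h1]

/-- **The handle twist `R_m` undoes `R_{-m}`**: `R_m (R_{-m} p) = p`, where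
`R_m p = (p₀, p₁, rot(2π m χ(p₀ + 1/2)) (p₂, p₃))` — the angle only depends on the unchanged
coordinate `p₀`. [folklore] -/
theorem handlebodyChart_rot_rot_neg (m : ℤ) (p : 𝔼4) :
    let R : ℤ → 𝔼4 → 𝔼4 := fun m p => !₂[p 0, p 1,
      Real.cos (2 * Real.pi * (m : ℝ) * Real.smoothTransition (p 0 + 1 / 2)) * p 2 -
        Real.sin (2 * Real.pi * (m : ℝ) * Real.smoothTransition (p 0 + 1 / 2)) * p 3,
      Real.sin (2 * Real.pi * (m : ℝ) * Real.smoothTransition (p 0 + 1 / 2)) * p 2 +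
        Real.cos (2 * Real.pi * (m : ℝ) * Real.smoothTransition (p 0 + 1 / 2)) * p 3]
    R m (R (-m) p) = p := by
  intro R
  set θ : ℝ := 2 * Real.pi * (m : ℝ) * Real.smoothTransition (p 0 + 1 / 2) with hθ
  have hneg : 2 * Real.pi * ((-m : ℤ) : ℝ) * Real.smoothTransition (p 0 + 1 / 2) = -θ := by
    rw [hθ]; push_cast; ring
  have h0 : (R (-m) p) 0 = p 0 := by simp [R]
  have hcs := Real.cos_sq_add_sin_sq θ
  ext i
  fin_cases i
  · simp [R]
  · simp [R]
  · simp only [R, Matrix.cons_val_zero, Matrix.cons_val_one, Matrix.cons_val,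
      hneg, Real.cos_neg, Real.sin_neg]
    show Real.cos θ * (Real.cos θ * p 2 - -Real.sin θ * p 3) -
        Real.sin θ * (-Real.sin θ * p 2 + Real.cos θ * p 3) = p 2
    linear_combination (p 2) * hcs
  · simp only [R, Matrix.cons_val_zero, Matrix.cons_val_one, Matrix.cons_val,
      hneg, Real.cos_neg, Real.sin_neg]
    show Real.sin θ * (Real.cos θ * p 2 - -Real.sin θ * p 3) +
        Real.cos θ * (-Real.sin θ * p 2 + Real.cos θ * p 3) = p 3
    linear_combination (p 3) * hcs

/-! ## Step (2): the arc step -/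

/-- **The arc step of stub D.**  Setting: a germ chart `i` on the open `U ⊆ ℝ⁴` of the closed
simply connected `4`-manifold `X`; a global chart `e₁ : ℝ⁴ → X` (smooth, injective, immersive,
an open embedding) which AGREES with `i` on the closed ball `B̄(c, 3a/2) ⊆ U`; and `k` model
handle charts `h j` (smooth injective immersions of an open `W ⊇ T`, `T` the solid cylinder, into
`U`, with pairwise disjoint images) entering the ball conically: `dist (h j p, c) = a (2 - |p₀|)`
for `|p₀| ≥ 1/2` and `≥ 3a/2` for `|p₀| ≤ 1/2`.  Then, granting the fact
`arcs_ambientIsotopic_rel_of_homotopicRel`, some diffeomorphism `Φ` of `X` fixes `e₁(B̄(c, 4a/3))`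
— so `Φ ∘ i = e₁` there — and carries every core arc `i ∘ h j ∘ (t, 0, 0, 0)` to
`e₁ ∘ h j ∘ (t, 0, 0, 0)`, `|t| ≤ 1`.  Proof: the two families of arcs agree for `|t| ≥ 1/2`
(inside the ball), are pairwise disjoint, and their middle parts lie in the simply connected
`X ∖ e₁(B(c, 3a/2))` (`handlebodyChart_simplyConnected_compl_ball`), hence are homotopic rel
`|t| ≥ 1/2` there (`handlebodyChart_homotopy`); the fact does the rest with
`Z = e₁(B̄(c, 4a/3))`. [folklore] -/
theorem handlebodyChart_arcStep {X : Type} [TopologicalSpace X] [T2Space X]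
    [SecondCountableTopology X] [CompactSpace X] [ChartedSpace 𝔼4 X] [IsManifold (𝓡 4) ∞ X]
    [SimplyConnectedSpace X] (hM2 : Literature.Topology.FourManifolds.arcs_ambientIsotopic_rel_of_homotopicRel)
    {U : Set 𝔼4} (hUo : IsOpen U) {i : 𝔼4 → X}
    (hi : ContMDiffOn (𝓡 4) (𝓡 4) ∞ i U ∧ InjOn i U ∧
      ∀ x ∈ U, Injective (mfderiv (𝓡 4) (𝓡 4) i x))
    {e₁ : 𝔼4 → X} (he : ContMDiff (𝓡 4) (𝓡 4) ∞ e₁ ∧ Injective e₁ ∧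
      ∀ x, Injective (mfderiv (𝓡 4) (𝓡 4) e₁ x))
    (heo : Topology.IsOpenEmbedding e₁) {c : 𝔼4} {a : ℝ} (ha : 0 < a)
    (hcU : closedBall c (3 * a / 2) ⊆ U) (hagree : ∀ x, dist x c ≤ 3 * a / 2 → e₁ x = i x)
    {k : ℕ} {W : Set 𝔼4} (hWo : IsOpen W)
    (hTW : {p : 𝔼4 | |p 0| ≤ 1 ∧ (p 1) ^ 2 + (p 2) ^ 2 + (p 3) ^ 2 ≤ 1} ⊆ W)
    {h : Fin k → 𝔼4 → 𝔼4}
    (hh : ∀ j, ContDiffOn ℝ ∞ (h j) W ∧ InjOn (h j) W ∧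
      (∀ p ∈ W, Injective (fderiv ℝ (h j) p)) ∧ MapsTo (h j) W U)
    (hdisj : ∀ j l, j ≠ l → ∀ p ∈ W, ∀ q ∈ W, h j p ≠ h l q)
    (hnear : ∀ j, ∀ p ∈ W, 1 / 2 ≤ |p 0| → dist (h j p) c = a * (2 - |p 0|))
    (hfar : ∀ j, ∀ p ∈ W, |p 0| ≤ 1 / 2 → 3 * a / 2 ≤ dist (h j p) c) :
    ∃ Φ : X ≃ₘ⟮𝓡 4, 𝓡 4⟯ X, (∀ x, dist x c ≤ 4 * a / 3 → Φ (i x) = e₁ x) ∧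
      ∀ j, ∀ t : ℝ, |t| ≤ 1 → Φ (i (h j !₂[t, 0, 0, 0])) = e₁ (h j !₂[t, 0, 0, 0]) := by
  obtain ⟨hLs, hLinj, hLd, hLc⟩ := helper_handlebodyChart_coreLine
  -- the core line and the parameter domain `V = L⁻¹(W) ⊇ [-1, 1]`
  set L : ℝ → 𝔼4 := fun t => !₂[t, 0, 0, 0] with hL
  have hL0 : ∀ t, (L t) 0 = t := fun t => (hLc t).1
  have hLT : ∀ t, |t| ≤ 1 → L t ∈ {p : 𝔼4 | |p 0| ≤ 1 ∧ (p 1) ^ 2 + (p 2) ^ 2 + (p 3) ^ 2 ≤ 1} :=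
    fun t ht => ⟨by rw [hL0]; exact ht, by rw [(hLc t).2.1, (hLc t).2.2.1, (hLc t).2.2.2]; norm_num⟩
  set V : Set ℝ := L ⁻¹' W with hV
  have hVo : IsOpen V := hWo.preimage hLs.continuous
  have hIV : Icc (-1 : ℝ) 1 ⊆ V := fun t ht => hTW (hLT t (abs_le.2 ⟨by linarith [ht.1], ht.2⟩))
  have hVW : ∀ t ∈ V, L t ∈ W := fun t ht => ht
  -- distances along the cores
  have hdist_le : ∀ j, ∀ t ∈ V, 1 / 2 ≤ |t| → dist (h j (L t)) c ≤ 3 * a / 2 := fun j t ht h12 => by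
    rw [hnear j (L t) (hVW t ht) (by rw [hL0]; exact h12), hL0]
    nlinarith
  have hdist_ge : ∀ j t, |t| ≤ 1 / 2 → 3 * a / 2 ≤ dist (h j (L t)) c := fun j t ht =>
    hfar j (L t) (hTW (hLT t (by linarith [abs_nonneg t]))) (by rw [hL0]; exact ht)
  -- the two families of arcs and their regularity
  set a₀ : Fin k → ℝ → X := fun j t => i (h j (L t)) with ha₀
  set a₁ : Fin k → ℝ → X := fun j t => e₁ (h j (L t)) with ha₁
  have he' : ContMDiffOn (𝓡 4) (𝓡 4) ∞ e₁ univ ∧ InjOn e₁ univ ∧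
      ∀ x ∈ univ, Injective (mfderiv (𝓡 4) (𝓡 4) e₁ x) :=
    ⟨he.1.contMDiffOn, he.2.1.injOn, fun x _ => he.2.2 x⟩
  have ht₀ : ∀ j, ContMDiffOn (𝓡 4) (𝓡 4) ∞ (i ∘ h j) W ∧ InjOn (i ∘ h j) W ∧
      ∀ p ∈ W, Injective (mfderiv (𝓡 4) (𝓡 4) (i ∘ h j) p) := fun j =>
    handlebodyChart_germ_comp hUo hi hWo (hh j).1 (hh j).2.1 (hh j).2.2.1 (hh j).2.2.2
  have ht₁ : ∀ j, ContMDiffOn (𝓡 4) (𝓡 4) ∞ (e₁ ∘ h j) W ∧ InjOn (e₁ ∘ h j) W ∧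
      ∀ p ∈ W, Injective (mfderiv (𝓡 4) (𝓡 4) (e₁ ∘ h j) p) := fun j =>
    handlebodyChart_germ_comp isOpen_univ he' hWo (hh j).1 (hh j).2.1 (hh j).2.2.1
      (mapsTo_univ _ _)
  have hra₀ : ∀ j, ContMDiffOn 𝓘(ℝ, ℝ) (𝓡 4) ∞ (a₀ j) V ∧ InjOn (a₀ j) V ∧
      ∀ t ∈ V, Injective (mfderiv 𝓘(ℝ, ℝ) (𝓡 4) (a₀ j) t) := fun j =>
    handlebodyChart_germ_comp (F := ℝ) hWo (ht₀ j) hVo hLs.contDiffOn hLinj.injOn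
      (fun t _ => hLd t) hVW
  have hra₁ : ∀ j, ContMDiffOn 𝓘(ℝ, ℝ) (𝓡 4) ∞ (a₁ j) V ∧ InjOn (a₁ j) V ∧
      ∀ t ∈ V, Injective (mfderiv 𝓘(ℝ, ℝ) (𝓡 4) (a₁ j) t) := fun j =>
    handlebodyChart_germ_comp (F := ℝ) hWo (ht₁ j) hVo hLs.contDiffOn hLinj.injOn
      (fun t _ => hLd t) hVW
  -- disjointness of distinct arcs
  have hWU : ∀ j, ∀ p ∈ W, h j p ∈ U := fun j p hp => (hh j).2.2.2 hp
  have hdis₀ : ∀ j l, j ≠ l → ∀ t ∈ V, ∀ s ∈ V, a₀ j t ≠ a₀ l s := fun j l hjl t ht s hs heq =>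
    hdisj j l hjl (L t) (hVW t ht) (L s) (hVW s hs)
      (hi.2.1 (hWU j _ (hVW t ht)) (hWU l _ (hVW s hs)) heq)
  have hdis₁ : ∀ j l, j ≠ l → ∀ t ∈ V, ∀ s ∈ V, a₁ j t ≠ a₁ l s := fun j l hjl t ht s hs heq =>
    hdisj j l hjl (L t) (hVW t ht) (L s) (hVW s hs) (he.2.1 heq)
  -- agreement of the outer parts
  have hagr : ∀ j, ∀ t ∈ V, 1 / 2 ≤ |t| → a₀ j t = a₁ j t := fun j t ht h12 =>
    (hagree _ (hdist_le j t ht h12)).symm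
  -- the simply connected complement of the base ball, and the arcs' middle parts in it
  set S : Set X := e₁ '' ball c (3 * a / 2) with hS
  haveI : SimplyConnectedSpace ↥(Sᶜ) :=
    handlebodyChart_simplyConnected_compl_ball heo c (by positivity)
  have hS₀ : ∀ j t, |t| ≤ 1 / 2 → a₀ j t ∉ S := by
    rintro j t ht ⟨s, hs, hse⟩
    have hs' : dist s c ≤ 3 * a / 2 := le_of_lt (mem_ball.1 hs)
    rw [hagree s hs'] at hse
    have hLW : L t ∈ W := hTW (hLT t (by linarith [abs_nonneg t]))
    have heq : s = h j (L t) := hi.2.1 (hcU (mem_closedBall.2 hs')) (hWU j _ hLW) hse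
    have := hdist_ge j t ht
    rw [← heq] at this
    linarith [mem_ball.1 hs]
  have hS₁ : ∀ j t, |t| ≤ 1 / 2 → a₁ j t ∉ S := by
    rintro j t ht ⟨s, hs, hse⟩
    have heq : s = h j (L t) := he.2.1 hse
    have := hdist_ge j t ht
    rw [← heq] at this
    linarith [mem_ball.1 hs]
  -- continuity of the arcs on `[-1, 1]`
  have hc₀ : ∀ j, ContinuousOn (a₀ j) (Icc (-1) 1) := fun j =>
    (hra₀ j).1.continuousOn.mono hIV
  have hc₁ : ∀ j, ContinuousOn (a₁ j) (Icc (-1) 1) := fun j =>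
    (hra₁ j).1.continuousOn.mono hIV
  -- the homotopies
  have hH : ∀ j, ∃ H : ℝ × ℝ → X, Continuous H ∧
      (∀ t ∈ Icc (-1 : ℝ) 1, H (0, t) = a₀ j t ∧ H (1, t) = a₁ j t) ∧
      (∀ s ∈ Icc (0 : ℝ) 1, ∀ t ∈ Icc (-1 : ℝ) 1, 1 / 2 ≤ |t| → H (s, t) = a₀ j t) ∧
      (∀ s ∈ Icc (0 : ℝ) 1, ∀ t ∈ Icc (-1 : ℝ) 1, |t| ≤ 1 / 2 → H (s, t) ∉ S) := fun j =>
    handlebodyChart_homotopy S (a₀ j) (a₁ j) (hc₀ j) (hc₁ j)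
      (fun t h12 h1 => hagr j t (hIV (abs_le.1 h1)) h12)
      (hS₀ j) (hS₁ j)
  choose H hHc hH01 hHst hHoff using hH
  -- the protected set `Z = e₁(B̄(c, 4a/3)) ⊆ S`
  set Z : Set X := e₁ '' closedBall c (4 * a / 3) with hZ
  have hZc : IsClosed Z := ((isCompact_closedBall c _).image he.1.continuous).isClosed
  have hZS : Z ⊆ S := image_mono fun x hx => mem_ball.2 (lt_of_le_of_lt (mem_closedBall.1 hx) (by nlinarith))
  -- apply the fact
  obtain ⟨Φ, hΦZ, hΦa⟩ := hM2 X k V a₀ a₁ H Z (1 / 2) (by norm_num) (by norm_num) hVo hIV hra₀ hra₁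
    hdis₀ hdis₁ (fun j t ht h12 => hagr j t ht (by linarith)) hHc hH01
    (fun j s hs t ht h12 => hHst j s hs t ht (by linarith)) hZc
    (fun j s hs t ht h12 hmem => hHoff j s hs t ht (by linarith) (hZS hmem))
  refine ⟨Φ, fun x hx => ?_, fun j t ht => hΦa j t (abs_le.1 ht |> fun h => ⟨by linarith [h.1], h.2⟩)⟩
  have hx' : dist x c ≤ 3 * a / 2 := hx.trans (by nlinarith)
  rw [← hagree x hx']
  exact hΦZ _ ⟨x, mem_closedBall.2 hx, rfl⟩

end Summit.SmoothPoincare4.SmoothPoincare4.Theorems.DcrGap.MkFriends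

end
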